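import Literature.AlgebraicGeometry.Frobenioids.Thm42SubWeak
import Literature.AlgebraicGeometry.Frobenioids.Thm42OfPreStepsGeneral
import Literature.AlgebraicGeometry.Frobenioids.FactorizationTransportWeak
import HarnessLib

/-!
# [FrdI] Theorem 4.2 / 4.9, WEAK setting: the constructors of `FrdI.T42.SettingWeak` from the printed
# hypotheses (perfect-type case; and at THE perfections)

Mochizuki, *The geometry of Frobenioids I: the general theory*, Kyushu J. Math. **62** (2008)
293–400, §4, Theorem 4.2, proof p. 78 ll. 28–46 ("we may assume without loss of generality that `C₁`, `C₂`
are … not of group-like type … by passing to the perfections … of perfect type") [cite: MochizukiFrdI2008, Thm. 4.2 (i) p.78];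
Theorem 3.4 (ii)(iii) p. 62; Prop. 3.2 (iii) (perfections are Frobenioids); Prop. 5.5 (iii) (standard type
passes to the perfection); Def. 2.4 (i) p. 48 ("`M^pf` is also perf-factorial").

PROOF-ONLY file (cell abc-iut, layer L1, seat abc-iut-L1-t14; row «C411iii/iv-WEAK», block (Σ)). WEAK-HYPOTHESIS
TWINS — "`Φ_i` perf-factorial" (Def. 2.4 (i) (a)–(d)) weakened to "`Φ_i` weakly perf-factorial"
(`IsPerfFactorialWeak`, (a)(b)(c) + (d_ord) + (d_res); cell finding F-L2d2-1) — of the three constructors of the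
frozen `FrdI.T42.Setting` that the Thm. 4.9 / Cor. 4.11 (iii)(iv) chain consumes, now valued in
`FrdI.T42.SettingWeak` (`Thm42SubWeak.lean`):
* `PreFrobenioidData.settingWeak_of_preservesPreSteps` — twin of `setting_of_preservesPreSteps`
  (`Thm42AssemblyOfPreSteps.lean`, seat abc-iut-w4-d105): perfect type, `Thm42Setting`, and "`Ψ`, `Ψ⁻¹`
  preserve pre-steps" give every field (Thm. 3.4 (iii) from pre-step preservation, `FrdI.OfPreSteps.*`,
  seat abc-iut-L1-t11) — verbatim, the monoid hypothesis is only stored;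
* `PreFrobenioidData.settingWeak_of_perfectType_asPrinted` — twin of `setting_of_perfectType_asPrinted`
  (`Thm42AssemblyPerfectAsPrinted.lean`): pre-steps preserved by `FrdI.isPreStep_map_of_isOfPerfectType` over
  the 2008 FSMFF bases of standard type (d);
* `FrdI.T42.settingWeak_perfection_asPrinted` — twin of `setting_perfection_asPrinted`
  (`Thm42OfPreStepsGeneral.lean`): the weak setting at THE perfections `Ψ^pf : C₁^pf ⥲ C₂^pf` from the PRINTED
  hypotheses on the `C_i` (`Thm42Setting`) and any Frobenius-compatibility witness of `Ψ`; `Φ_i^pf` weakly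
  perf-factorial by `IsPerfFactorialWeak.perfection` (`FactorizationTransportWeak.lean`, seat abc-iut-L2-d2) in
  place of `PerfectionIsPerfFactorial_holds`.
The printed case of each is the strong constructor followed by `Setting.weak`. No new definitions; no landed
declaration touched; nothing of the paper restated or strengthened; nothing here is specific to the abc programme
and no side is taken on [IUTchIII] Cor. 3.12.
-/

namespace Literature.AlgebraicGeometry.Frobenioids

open CategoryTheory Opposite

universe w v v' u u'

namespace PreFrobenioidData

variable {D : Type u} [Category.{v} D] {Φ : Dᵒᵖ ⥤ CommMonCat.{w}} {C : Type u'} [Category.{v'} C]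
  {F : C ⥤ ElemFrobenioid Φ}
  {D₂ : Type u} [Category.{v} D₂] {Φ₂ : D₂ᵒᵖ ⥤ CommMonCat.{w}} {C₂ : Type u'} [Category.{v'} C₂]
  {F₂ : C₂ ⥤ ElemFrobenioid Φ₂} (Ψ : C ≌ C₂)

/-- **The WEAK setting of the proof of Thm. 4.2, perfect-type case, from "`Ψ`, `Ψ⁻¹` preserve pre-steps"**:
for Frobenioids of perfect type with `Φ_i` weakly perf-factorial under `Thm42Setting` (standard ∧ isotropic ∧ not
group-like), pre-step preservation for `Ψ` and `Ψ⁻¹` supplies every field of `FrdI.T42.SettingWeak` — steps,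
Frobenius-type arrows, degrees and pull-backs by Thm. 3.4 (iii) from pre-step preservation (`FrdI.OfPreSteps.*`).
Twin of `setting_of_preservesPreSteps`. [cite: MochizukiFrdI2008, Thm. 3.4 (iii) p.62] -/
theorem settingWeak_of_preservesPreSteps (hF : PreFrobenioid.IsFrobenioid F) (hF₂ : PreFrobenioid.IsFrobenioid F₂)
    (hperf : PreFrobenioid.IsOfPerfectType F) (hperf₂ : PreFrobenioid.IsOfPerfectType F₂)
    (hpf : Objectwise (fun M _ => IsPerfFactorialWeak M) Φ)
    (hpf₂ : Objectwise (fun M _ => IsPerfFactorialWeak M) Φ₂)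
    (hΨ : ∀ ⦃X Y : C⦄ (φ : X ⟶ Y),
      PreFrobenioid.IsPreStep F φ → PreFrobenioid.IsPreStep F₂ (Ψ.functor.map φ))
    (hΨ' : ∀ ⦃X Y : C₂⦄ (φ : X ⟶ Y),
      PreFrobenioid.IsPreStep F₂ φ → PreFrobenioid.IsPreStep F (Ψ.inverse.map φ))
    (hT : Thm42Setting (ofFunctor Φ F) (ofFunctor Φ₂ F₂)) :
    FrdI.T42.SettingWeak F F₂ Ψ := by
  have histr : PreFrobenioid.IsOfIsotropicType F := (ofFunctor_isOfIsotropicType F).mp hT.isotropic.1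
  have histr₂ : PreFrobenioid.IsOfIsotropicType F₂ := (ofFunctor_isOfIsotropicType F₂).mp hT.isotropic.2
  have hq := hT.standard.1.quasiIsotropic
  have hq₂ := hT.standard.2.quasiIsotropic
  have hnd : Literature.AlgebraicGeometry.Frobenioids.IsNonDilatingOn Φ :=
    FrdI.isNonDilatingOn_of_ofFunctor hT.standard.1.nonDilating
  have hnd₂ : Literature.AlgebraicGeometry.Frobenioids.IsNonDilatingOn Φ₂ :=
    FrdI.isNonDilatingOn_of_ofFunctor hT.standard.2.nonDilating
  obtain ⟨N₁, hN₁⟩ : ∃ A : C, ¬ PreFrobenioid.IsGroupLikeObj F A := by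
    have h := hT.notGroupLike.1
    rw [isOfGroupLikeType_iff] at h
    simpa only [ofFunctor_isGroupLikeObj, not_forall] using h
  obtain ⟨N₂, hN₂⟩ : ∃ A : C₂, ¬ PreFrobenioid.IsGroupLikeObj F₂ A := by
    have h := hT.notGroupLike.2
    rw [isOfGroupLikeType_iff] at h
    simpa only [ofFunctor_isGroupLikeObj, not_forall] using h
  -- the implicit-binder forms consumed by the `FrdI.OfPreSteps` chain, for `Ψ` and for `Ψ⁻¹`
  have h₁ : ∀ ⦃X Y : C⦄ ⦃φ : X ⟶ Y⦄,
      PreFrobenioid.IsPreStep F φ → PreFrobenioid.IsPreStep F₂ (Ψ.functor.map φ) := fun _ _ φ h => hΨ φ h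
  have h₂ : ∀ ⦃X Y : C₂⦄ ⦃φ : X ⟶ Y⦄,
      PreFrobenioid.IsPreStep F₂ φ → PreFrobenioid.IsPreStep F (Ψ.inverse.map φ) := fun _ _ φ h => hΨ' φ h
  exact
    { isFrobenioid₁ := hF
      isFrobenioid₂ := hF₂
      perfect₁ := hperf
      perfect₂ := hperf₂
      isotropic₁ := histr
      isotropic₂ := histr₂
      perfFactorial₁ := hpf
      perfFactorial₂ := hpf₂
      preStep_map := hΨ
      preStep_inv := hΨ'
      step_map := fun _ _ _ hφ => FrdI.OfPreSteps.isStep_map Ψ h₁ hφ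
      step_inv := fun _ _ _ hφ => FrdI.OfPreSteps.isStep_map Ψ.symm h₂ hφ
      frobeniusType_map := fun _ _ _ hφ =>
        FrdI.OfPreSteps.isFrobeniusType_map_quasiIsotropic hF hF₂ hq hq₂ hnd hnd₂ Ψ h₁ h₂ hN₁ hN₂ hφ
      frobeniusType_inv := fun _ _ _ hφ =>
        FrdI.OfPreSteps.isFrobeniusType_map_quasiIsotropic hF₂ hF hq₂ hq hnd₂ hnd Ψ.symm h₂ h₁ hN₂ hN₁ hφ
      degFr_map := fun _ _ φ => FrdI.OfPreSteps.degFr_map hF hF₂ hq hq₂ hnd hnd₂ Ψ h₁ h₂ hN₁ hN₂ φ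
      pullback_map := fun _ _ _ hφ =>
        FrdI.OfPreSteps.isPullbackMorphism_map_quasiIsotropic hF hF₂ hq hq₂ hnd hnd₂ Ψ h₁ h₂ hN₁ hN₂ hφ
      pullback_inv := fun _ _ _ hφ =>
        FrdI.OfPreSteps.isPullbackMorphism_map_quasiIsotropic hF₂ hF hq₂ hq hnd₂ hnd Ψ.symm h₂ h₁ hN₂ hN₁
          hφ }

/-- **The WEAK setting of the proof of Thm. 4.2 from the PRINTED hypotheses, perfect-type case**: for Frobenioids
of perfect type with `Φ_i` weakly perf-factorial, `Thm42Setting` supplies every field of `FrdI.T42.SettingWeak` —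
pre-steps preserved by `FrdI.isPreStep_map_of_isOfPerfectType` over the 2008 FSMFF bases of standard type (d).
Twin of `setting_of_perfectType_asPrinted`. [cite: MochizukiFrdI2008, Thm. 3.4 (ii) p.62] -/
theorem settingWeak_of_perfectType_asPrinted (hF : PreFrobenioid.IsFrobenioid F)
    (hF₂ : PreFrobenioid.IsFrobenioid F₂) (hperf : PreFrobenioid.IsOfPerfectType F)
    (hperf₂ : PreFrobenioid.IsOfPerfectType F₂) (hpf : Objectwise (fun M _ => IsPerfFactorialWeak M) Φ)
    (hpf₂ : Objectwise (fun M _ => IsPerfFactorialWeak M) Φ₂)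
    (hT : Thm42Setting (ofFunctor Φ F) (ofFunctor Φ₂ F₂)) : FrdI.T42.SettingWeak F F₂ Ψ :=
  have histr : PreFrobenioid.IsOfIsotropicType F := (ofFunctor_isOfIsotropicType F).mp hT.isotropic.1
  have histr₂ : PreFrobenioid.IsOfIsotropicType F₂ := (ofFunctor_isOfIsotropicType F₂).mp hT.isotropic.2
  settingWeak_of_preservesPreSteps Ψ hF hF₂ hperf hperf₂ hpf hpf₂
    (fun _ _ _ hφ => FrdI.isPreStep_map_of_isOfPerfectType hF hF₂ histr histr₂ hperf hT.standard.2.fsmff Ψ hφ)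
    (fun _ _ _ hφ =>
      FrdI.isPreStep_map_of_isOfPerfectType hF₂ hF histr₂ histr hperf₂ hT.standard.1.fsmff Ψ.symm hφ) hT

end PreFrobenioidData

namespace FrdI.T42

open PreFrobenioidData PreFrobenioid.Perfection

variable {D₁ : Type u} [Category.{v} D₁] {Φ₁ : D₁ᵒᵖ ⥤ CommMonCat.{w}} {C₁ : Type u'} [Category.{v'} C₁]
  {D₂ : Type u} [Category.{v} D₂] {Φ₂ : D₂ᵒᵖ ⥤ CommMonCat.{w}} {C₂ : Type u'} [Category.{v'} C₂]
  {F₁ : C₁ ⥤ ElemFrobenioid Φ₁} {F₂ : C₂ ⥤ ElemFrobenioid Φ₂} (Ψ : C₁ ≌ C₂)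

/-- **The WEAK setting of the proof of Thm. 4.2 at THE perfections `C₁^pf ⥲ C₂^pf`, from the PRINTED hypotheses
on the `C_i`** (`Thm42Setting`: standard and isotropic type, not of group-like type; `Φ_i` weakly perf-factorial)
and ANY witness `hΨ` that `Ψ` is compatible with arrows of Frobenius type (so that `Ψ^pf` is defined): `C_i^pf`
is a Frobenioid (Prop. 3.2 (iii)) of perfect, isotropic, standard (Prop. 5.5 (iii)) and non-group-like type, and
`Φ_i^pf` is weakly perf-factorial (`IsPerfFactorialWeak.perfection`), whence
`settingWeak_of_perfectType_asPrinted`. Twin of `setting_perfection_asPrinted`.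
[cite: MochizukiFrdI2008, Thm. 4.2 (i) p.78] -/
theorem settingWeak_perfection_asPrinted (hF₁ : PreFrobenioid.IsFrobenioid F₁)
    (hF₂ : PreFrobenioid.IsFrobenioid F₂)
    (hpf₁ : Objectwise (fun M _ => IsPerfFactorialWeak M) Φ₁)
    (hpf₂ : Objectwise (fun M _ => IsPerfFactorialWeak M) Φ₂)
    (hT : Thm42Setting (ofFunctor Φ₁ F₁) (ofFunctor Φ₂ F₂))
    (hΨ : PreFrobenioid.IsFrobeniusCompatible F₁ F₂ Ψ.functor) :
    haveI := map_isEquivalence (hF₁ := hF₁) (hF₂ := hF₂) Ψ hΨ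
    SettingWeak (ops hF₁).toFunctor (ops hF₂).toFunctor (map (hF₁ := hF₁) (hF₂ := hF₂) hΨ).asEquivalence := by
  haveI := map_isEquivalence (hF₁ := hF₁) (hF₂ := hF₂) Ψ hΨ
  obtain ⟨hi₁, hi₂, -, -, ⟨N₁, hN₁⟩, ⟨N₂, hN₂⟩⟩ := of_thm42Setting hT
  have hs₁ := hT.standard.1
  have hs₂ := hT.standard.2
  have hiso₁ := isFrobeniusIsotropic_of_isOfIsotropicType hF₁ hi₁
  have hiso₂ := isFrobeniusIsotropic_of_isOfIsotropicType hF₂ hi₂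
  -- Prop. 3.2 (iii): the perfections are Frobenioids
  have hPf₁ := PreFrobenioid.Perfection.isFrobenioid hF₁ hiso₁
  have hPf₂ := PreFrobenioid.Perfection.isFrobenioid hF₂ hiso₂
  -- Prop. 5.5 (iii): of standard type
  have hng₁ : ¬ PreFrobenioid.IsOfType (PreFrobenioid.IsGroupLikeObj F₁) := fun h => hN₁ (h N₁)
  have hng₂ : ¬ PreFrobenioid.IsOfType (PreFrobenioid.IsGroupLikeObj F₂) := fun h => hN₂ (h N₂)
  have hnorm₁ : PreFrobenioid.IsOfType (PreFrobenioid.IsFrobeniusNormalized F₁) :=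
    fun X => hs₁.frobeniusNormalized.obj X
  have hnorm₂ : PreFrobenioid.IsOfType (PreFrobenioid.IsFrobeniusNormalized F₂) :=
    fun X => hs₂.frobeniusNormalized.obj X
  have hsP₁ := FrdI.Prop55Sub.prop55iii_pf_standard_of_not_groupLike hF₁ hPf₁ hng₁ hiso₁ hnorm₁ hs₁
  have hsP₂ := FrdI.Prop55Sub.prop55iii_pf_standard_of_not_groupLike hF₂ hPf₂ hng₂ hiso₂ hnorm₂ hs₂
  -- `Thm42Setting` for the perfections: standard, isotropic, not group-like (the objects `(N_i, 1)`)
  have hT' : Thm42Setting (ops hF₁) (ops hF₂) :=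
    ⟨⟨hsP₁, hsP₂⟩, ⟨isOfIsotropicType_perfection hF₁ hiso₁, isOfIsotropicType_perfection hF₂ hiso₂⟩,
      ⟨fun h => hN₁ ((isGroupLikeObj_ops_iff (hF := hF₁) _).1 (h.obj ((toPf hF₁).obj N₁))),
        fun h => hN₂ ((isGroupLikeObj_ops_iff (hF := hF₂) _).1 (h.obj ((toPf hF₂).obj N₂)))⟩⟩
  exact settingWeak_of_perfectType_asPrinted (map (hF₁ := hF₁) (hF₂ := hF₂) hΨ).asEquivalence hPf₁ hPf₂
    ((ofFunctor_isOfPerfectType (ops hF₁).toFunctor).1 (isOfPerfectType_perfection hF₁ hiso₁))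
    ((ofFunctor_isOfPerfectType (ops hF₂).toFunctor).1 (isOfPerfectType_perfection hF₂ hiso₂))
    (fun X => (hpf₁ X).perfection) (fun X => (hpf₂ X).perfection) hT'

end FrdI.T42

end Literature.AlgebraicGeometry.Frobenioids
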